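import Summits.KontsevichZagierPeriods.KontsevichZagierPeriods.Theorems.HurwitzMicroSectorsNormalFormPrincipleM3EbdExistsSimplexReps
import Summits.KontsevichZagierPeriods.KontsevichZagierPeriods.Theorems.OctahedralSymmetryOctahedralInvolutionMove

/-!
# `NormalFormPrinciple` (stmt-KontsevichZagierPeriods-3869), line `SketchIdeator1` —
# leaf `stub_boxRigidity`, layer `L2W3` (level-2 weight-3 descent): the Möbius move on `Δ`

Pure proof file (registered sub-goal `l2w3_moebius_move` of the layer `L2W3`, lead seat c9;
`--supports` the crux). On the decreasing open simplex
`Δ = {t | 0 < t₂ < t₁ < t₀ < 1} ⊆ ℝ³` a *word representation* is `[Δ, x(t₀) y(t₁) z(t₂)]` for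
letters `x, y, z : ℝ → ℝ` (the iterated integral `∫ x y z` over `1 > t₀ > t₁ > t₂ > 0`). The MÖBIUS
INVOLUTION `σ(u) = (1 − u)/(1 + u)` of `(0,1)` (decreasing, `σ 0 = 1`, `σ 1 = 0`, `σ ∘ σ = id`,
`σ'(u) = −2/(1 + u)²`), applied to all three coordinates WITH ORDER REVERSAL,

  `Φ(t) = (σ t₂, σ t₁, σ t₀)`,  `Φ '' Δ = Δ`,  `|det DΦ(t)| = (2/(1+t₀)²)(2/(1+t₁)²)(2/(1+t₂)²)`,

is ONE change of variables of the Kontsevich–Zagier calculus (rule (2), `KZ.changeOfVariablesRel`)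
between the word representation `T = [Δ, x(t₀) y(t₁) z(t₂)]` and ANY representation `N` on `Δ`
carrying the pulled-back integrand
`N(t) = (z(σ t₀)·2/(1+t₀)²)(y(σ t₁)·2/(1+t₁)²)(x(σ t₂)·2/(1+t₂)²) = T(Φ t)·|det DΦ(t)|`
(part (1), `l2m_moebius_sub_mem_relations`); and such a representation `N` EXISTS (part (2),
`l2m_exists_moebiusRep`): its integrand is `ℚ`-semialgebraic on `Δ` as the composite of the
`ℚ`-semialgebraic integrand of `T` with the `ℚ`-rational chart times the `ℚ`-rational Jacobian,
and absolutely integrable on `Δ` by transport of `T.integrableOn` along the chart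
(`MeasureTheory.integrableOn_image_iff_integrableOn_abs_det_fderiv_smul`, `Φ '' Δ = Δ`).

The chart itself — Zhao's octahedral involution in every dimension `w`, here `w = 3` — is the
tree's `OctahedralSymmetry.OctahedralInvolutionMove` kit (`OctahedralInvolutionMove_of`,
`hasFDerivAt_octMap`, `abs_det_octDeriv`, `bijOn_octMap`, `mapsTo_octMap`,
`isSemialgebraicMapOn_octMap`), read on `Δ = KZ.openOrderedSimplex 3`
(`M3.ebd2_simplex_eq_openOrderedSimplex`); this file only supplies the pull-back identity for word
integrands and the two transports.

References: M. Kontsevich, D. Zagier, *Periods* (2001), §1.1–1.2, rule (2); J. Zhao, *Multiple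
polylogarithm values at roots of unity*, C. R. Acad. Sci. Paris 346 (2008), §4 (the involution
`σ`). No definitions are introduced.
-/

noncomputable section

open MeasureTheory Set
open Literature.NumberTheory.Transcendental Literature.NumberTheory.Transcendental.KZ
open Literature.ModelTheory.ExponentialFields (IsSemialgebraic)
open Summit.KontsevichZagierPeriods.OctahedralSymmetry.OctahedralInvolutionMove
  (OctahedralInvolutionMove_of hasFDerivAt_octMap abs_det_octDeriv bijOn_octMap mapsTo_octMap
    isSemialgebraicMapOn_octMap one_add_ne_zero_of_mem_simplex)

namespace Summit.KontsevichZagierPeriods.HurwitzMicroSectors.NormalFormPrinciple.PiBox.M3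

/-! ## The Möbius chart on the decreasing open simplex -/

/-- On the decreasing open simplex no coordinate is `−1` (indeed `1 + tᵢ > 0`): the Möbius chart
`σ(u) = (1 − u)/(1 + u)` has no pole there. [folklore] -/
theorem l2m_one_add_ne_zero {t : Fin 3 → ℝ}
    (ht : t ∈ {t : Fin 3 → ℝ | 0 < t 2 ∧ t 2 < t 1 ∧ t 1 < t 0 ∧ t 0 < 1}) (i : Fin 3) :
    1 + t i ≠ 0 :=
  one_add_ne_zero_of_mem_simplex (w := 3) (ebd2_simplex_eq_openOrderedSimplex.le ht) i

/-- The Möbius chart `Φ(t)ⱼ = σ(t_{2−j})`, `σ(u) = (1 − u)/(1 + u)`, maps the decreasing open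
simplex into itself (`σ` is a decreasing self-map of `(0,1)` and the order reversal restores the
ordering of the coordinates). [folklore] -/
theorem l2m_moebius_mem_simplex {t : Fin 3 → ℝ}
    (ht : t ∈ {t : Fin 3 → ℝ | 0 < t 2 ∧ t 2 < t 1 ∧ t 1 < t 0 ∧ t 0 < 1}) :
    (fun j : Fin 3 => (1 - t (Fin.rev j)) / (1 + t (Fin.rev j))) ∈
      {t : Fin 3 → ℝ | 0 < t 2 ∧ t 2 < t 1 ∧ t 1 < t 0 ∧ t 0 < 1} :=
  ebd2_simplex_eq_openOrderedSimplex.symm.le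
    (mapsTo_octMap (w := 3) (ebd2_simplex_eq_openOrderedSimplex.le ht))

/-- Each Jacobian factor `2/(1 + tᵢ)²` of the Möbius chart is a `ℚ`-semialgebraic function on the
decreasing open simplex: a quotient of `ℚ`-polynomials whose denominator does not vanish there.
[cite: KontsevichZagier2001, §1.1] -/
theorem l2m_isSemialgebraicFunOn_jacFactor (i : Fin 3) :
    IsSemialgebraicFunOn ℚ {t : Fin 3 → ℝ | 0 < t 2 ∧ t 2 < t 1 ∧ t 1 < t 0 ∧ t 0 < 1}
      (fun t => 2 / (1 + t i) ^ 2) := by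
  refine (isSemialgebraicFunOn_aeval_div_aeval ebd2_isSemialgebraic_simplex
    (2 : MvPolynomial (Fin 3) ℚ) ((1 + MvPolynomial.X i) ^ 2) fun t ht => ?_).congr fun t _ => ?_
  · simp only [map_pow, map_add, map_one, MvPolynomial.aeval_X]
    exact pow_ne_zero 2 (l2m_one_add_ne_zero ht i)
  · simp only [map_ofNat, map_pow, map_add, map_one, MvPolynomial.aeval_X]

/-- The Jacobian `|det DΦ(t)| = (2/(1+t₀)²)(2/(1+t₁)²)(2/(1+t₂)²)` of the Möbius chart is a
`ℚ`-semialgebraic function on the decreasing open simplex (a product of three `ℚ`-semialgebraic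
functions). [cite: KontsevichZagier2001, §1.1] -/
theorem l2m_isSemialgebraicFunOn_jac :
    IsSemialgebraicFunOn ℚ {t : Fin 3 → ℝ | 0 < t 2 ∧ t 2 < t 1 ∧ t 1 < t 0 ∧ t 0 < 1}
      (fun t => 2 / (1 + t 0) ^ 2 * (2 / (1 + t 1) ^ 2) * (2 / (1 + t 2) ^ 2)) :=
  (IsSemialgebraicFunOn.mul_holds
    (IsSemialgebraicFunOn.mul_holds (l2m_isSemialgebraicFunOn_jacFactor 0)
      (l2m_isSemialgebraicFunOn_jacFactor 1)) (l2m_isSemialgebraicFunOn_jacFactor 2)).congr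
    fun _ _ => rfl

/-- **The pull-back identity of the Möbius chart for word integrands.** If
`T(u) = x(u₀) y(u₁) z(u₂)` on `Δ`, then at `u = Φ(t) = (σ t₂, σ t₁, σ t₀)`, `t ∈ Δ`,
`T(Φ t) · (2/(1+t₀)²)(2/(1+t₁)²)(2/(1+t₂)²) = (z(σ t₀)·2/(1+t₀)²)(y(σ t₁)·2/(1+t₁)²)(x(σ t₂)·2/(1+t₂)²)`
(the letters come out in the reversed order `z y x`). [folklore] -/
theorem l2m_moebius_pullback (x y z : ℝ → ℝ) (T : IntegralRep 3)
    (hTd : T.domain = {t | 0 < t 2 ∧ t 2 < t 1 ∧ t 1 < t 0 ∧ t 0 < 1})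
    (hTi : EqOn T.integrand (fun t => x (t 0) * y (t 1) * z (t 2)) T.domain) {t : Fin 3 → ℝ}
    (ht : t ∈ {t : Fin 3 → ℝ | 0 < t 2 ∧ t 2 < t 1 ∧ t 1 < t 0 ∧ t 0 < 1}) :
    T.integrand (fun j : Fin 3 => (1 - t (Fin.rev j)) / (1 + t (Fin.rev j))) *
        (2 / (1 + t 0) ^ 2 * (2 / (1 + t 1) ^ 2) * (2 / (1 + t 2) ^ 2)) =
      z ((1 - t 0) / (1 + t 0)) * (2 / (1 + t 0) ^ 2) *
        (y ((1 - t 1) / (1 + t 1)) * (2 / (1 + t 1) ^ 2)) *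
        (x ((1 - t 2) / (1 + t 2)) * (2 / (1 + t 2) ^ 2)) := by
  have hΦt : (fun j : Fin 3 => (1 - t (Fin.rev j)) / (1 + t (Fin.rev j))) ∈ T.domain :=
    hTd.symm.le (l2m_moebius_mem_simplex ht)
  have r0 : Fin.rev (0 : Fin 3) = 2 := by decide
  have r1 : Fin.rev (1 : Fin 3) = 1 := by decide
  have r2 : Fin.rev (2 : Fin 3) = 0 := by decide
  rw [hTi hΦt]
  simp only [r0, r1, r2]
  ring

/-! ## Part 1: the Möbius move (rule 2) -/

/-- **The Möbius move (rule 2).** For letters `x, y, z : ℝ → ℝ`, a representation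
`T = [Δ, x(t₀) y(t₁) z(t₂)]` (integrand pinned on the domain only) and ANY representation `N` on
`Δ` whose integrand agrees on `Δ` with the pulled-back integrand
`(z(σ t₀)·2/(1+t₀)²)(y(σ t₁)·2/(1+t₁)²)(x(σ t₂)·2/(1+t₂)²)`, `σ(u) = (1 − u)/(1 + u)`, the difference
`[N] − [T]` is ONE change-of-variables move of the Kontsevich–Zagier calculus along the Möbius
chart `Φ(t) = (σ t₂, σ t₁, σ t₀)` of `Δ` onto itself (Zhao's octahedral involution in dimension
`3`, `OctahedralInvolutionMove_of`), the pull-back identity `N(t) = T(Φ t)·|det DΦ(t)|` on `Δ` being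
`l2m_moebius_pullback`. [cite: KontsevichZagier2001, §1.2 rule (2)] -/
theorem l2m_moebius_sub_mem_relations (x y z : ℝ → ℝ) (T : IntegralRep 3)
    (hTd : T.domain = {t | 0 < t 2 ∧ t 2 < t 1 ∧ t 1 < t 0 ∧ t 0 < 1})
    (hTi : EqOn T.integrand (fun t => x (t 0) * y (t 1) * z (t 2)) T.domain)
    (N : IntegralRep 3) (hNd : N.domain = {t | 0 < t 2 ∧ t 2 < t 1 ∧ t 1 < t 0 ∧ t 0 < 1})
    (hNi : EqOn N.integrand (fun t => (z ((1 - t 0) / (1 + t 0)) * (2 / (1 + t 0) ^ 2)) *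
      (y ((1 - t 1) / (1 + t 1)) * (2 / (1 + t 1) ^ 2)) *
      (x ((1 - t 2) / (1 + t 2)) * (2 / (1 + t 2) ^ 2))) N.domain) :
    of N - of T ∈ relations := by
  refine changeOfVariablesRel_subset_relations
    (OctahedralInvolutionMove_of 3 N T (hNd.trans ebd2_simplex_eq_openOrderedSimplex)
      (hTd.trans ebd2_simplex_eq_openOrderedSimplex) fun t ht => ?_)
  -- the pull-back identity on `N.domain = Δ`, Jacobian `∏ⱼ 2/(1+tⱼ)²` included
  rw [hNi ht, Fin.prod_univ_three]
  exact (l2m_moebius_pullback x y z T hTd hTi (hNd.le ht)).symm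

/-! ## Part 2: the Möbius carrier exists -/

/-- **The pulled-back representation exists.** For letters `x, y, z : ℝ → ℝ` and a representation
`T = [Δ, x(t₀) y(t₁) z(t₂)]` (integrand pinned on the domain only), the decreasing open simplex
`Δ` with the pulled-back integrand `(z(σ t₀)·2/(1+t₀)²)(y(σ t₁)·2/(1+t₁)²)(x(σ t₂)·2/(1+t₂)²)` is
an integral representation of the Kontsevich–Zagier calculus: on `Δ` this integrand equals
`T(Φ t)·|det DΦ(t)|` (`l2m_moebius_pullback`), which is `ℚ`-semialgebraic there (composite of
`T.integrand` with the `ℚ`-rational chart, `IsSemialgebraicFunOn.comp_isSemialgebraicMapOn_holds`,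
times the `ℚ`-rational Jacobian) and absolutely integrable there (transport of `T.integrableOn`
along the chart, `Φ '' Δ = Δ`, by
`MeasureTheory.integrableOn_image_iff_integrableOn_abs_det_fderiv_smul`). Nothing about the
letters is used beyond what `T` provides. [cite: KontsevichZagier2001, §1.1–1.2] -/
theorem l2m_exists_moebiusRep (x y z : ℝ → ℝ) (T : IntegralRep 3)
    (hTd : T.domain = {t | 0 < t 2 ∧ t 2 < t 1 ∧ t 1 < t 0 ∧ t 0 < 1})
    (hTi : EqOn T.integrand (fun t => x (t 0) * y (t 1) * z (t 2)) T.domain) :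
    ∃ N : IntegralRep 3, N.domain = {t | 0 < t 2 ∧ t 2 < t 1 ∧ t 1 < t 0 ∧ t 0 < 1} ∧
      N.integrand = fun t => (z ((1 - t 0) / (1 + t 0)) * (2 / (1 + t 0) ^ 2)) *
        (y ((1 - t 1) / (1 + t 1)) * (2 / (1 + t 1) ^ 2)) *
        (x ((1 - t 2) / (1 + t 2)) * (2 / (1 + t 2) ^ 2)) := by
  -- the chart is `ℚ`-semialgebraic on `Δ` and maps `Δ` into `T.domain = Δ`
  have hF : IsSemialgebraicMapOn ℚ {t : Fin 3 → ℝ | 0 < t 2 ∧ t 2 < t 1 ∧ t 1 < t 0 ∧ t 0 < 1}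
      (fun (t : Fin 3 → ℝ) (j : Fin 3) => (1 - t (Fin.rev j)) / (1 + t (Fin.rev j))) :=
    isSemialgebraicMapOn_octMap ebd2_isSemialgebraic_simplex fun _ ht => l2m_one_add_ne_zero ht
  have hmaps : MapsTo (fun (t : Fin 3 → ℝ) (j : Fin 3) => (1 - t (Fin.rev j)) / (1 + t (Fin.rev j)))
      {t : Fin 3 → ℝ | 0 < t 2 ∧ t 2 < t 1 ∧ t 1 < t 0 ∧ t 0 < 1} T.domain :=
    fun t ht => hTd.symm.le (l2m_moebius_mem_simplex ht)
  -- the pulled-back integrand `(T.integrand ∘ Φ) · |det DΦ|` is `ℚ`-semialgebraic on `Δ`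
  have hsa : IsSemialgebraicFunOn ℚ {t : Fin 3 → ℝ | 0 < t 2 ∧ t 2 < t 1 ∧ t 1 < t 0 ∧ t 0 < 1}
      (fun t => (z ((1 - t 0) / (1 + t 0)) * (2 / (1 + t 0) ^ 2)) *
        (y ((1 - t 1) / (1 + t 1)) * (2 / (1 + t 1) ^ 2)) *
        (x ((1 - t 2) / (1 + t 2)) * (2 / (1 + t 2) ^ 2))) :=
    (IsSemialgebraicFunOn.mul_holds
      (IsSemialgebraicFunOn.comp_isSemialgebraicMapOn_holds T.isSemialgebraicFunOn_integrand hF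
        hmaps) l2m_isSemialgebraicFunOn_jac).congr
      fun t ht => l2m_moebius_pullback x y z T hTd hTi ht
  -- ... and absolutely integrable on `Δ`: transport of `T.integrableOn` along the chart
  have hint : IntegrableOn
      (fun t => (z ((1 - t 0) / (1 + t 0)) * (2 / (1 + t 0) ^ 2)) *
        (y ((1 - t 1) / (1 + t 1)) * (2 / (1 + t 1) ^ 2)) *
        (x ((1 - t 2) / (1 + t 2)) * (2 / (1 + t 2) ^ 2)))
      {t : Fin 3 → ℝ | 0 < t 2 ∧ t 2 < t 1 ∧ t 1 < t 0 ∧ t 0 < 1} := by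
    have hinj : InjOn (fun (t : Fin 3 → ℝ) (j : Fin 3) => (1 - t (Fin.rev j)) / (1 + t (Fin.rev j)))
        {t : Fin 3 → ℝ | 0 < t 2 ∧ t 2 < t 1 ∧ t 1 < t 0 ∧ t 0 < 1} :=
      fun a ha b hb hab => (bijOn_octMap (w := 3)).injOn (ebd2_simplex_eq_openOrderedSimplex.le ha)
        (ebd2_simplex_eq_openOrderedSimplex.le hb) hab
    have hsub : (fun (t : Fin 3 → ℝ) (j : Fin 3) => (1 - t (Fin.rev j)) / (1 + t (Fin.rev j))) ''
        {t : Fin 3 → ℝ | 0 < t 2 ∧ t 2 < t 1 ∧ t 1 < t 0 ∧ t 0 < 1} ⊆ T.domain := by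
      rintro _ ⟨u, hu, rfl⟩
      exact hmaps hu
    have key := (integrableOn_image_iff_integrableOn_abs_det_fderiv_smul volume
      ebd2_measurableSet_simplex
      (fun t ht => (hasFDerivAt_octMap (l2m_one_add_ne_zero ht)).hasFDerivWithinAt) hinj
      T.integrand).1 (T.integrableOn.mono_set hsub)
    refine key.congr_fun (fun t ht => ?_) ebd2_measurableSet_simplex
    simp only [smul_eq_mul, abs_det_octDeriv, Fin.prod_univ_three]
    exact (mul_comm _ _).trans (l2m_moebius_pullback x y z T hTd hTi ht)
  exact ⟨⟨_, _, ebd2_isSemialgebraic_simplex, hsa, hint⟩, rfl, rfl⟩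

/-! ## The registered sub-goal -/

/-- **Stub L3 (`l2w3_moebius_move`; registered sub-goal of stmt-KontsevichZagierPeriods-3869, line
`SketchIdeator1`, layer `L2W3`).** The Möbius involution `σ(u) = (1 − u)/(1 + u)` applied to all
three coordinates with order reversal, `Φ(t) = (σ t₂, σ t₁, σ t₀)`, maps the decreasing open
simplex `Δ = {0 < t₂ < t₁ < t₀ < 1}` onto itself with
`|det DΦ(t)| = 8/((1+t₀)²(1+t₁)²(1+t₂)²)`; for a word representation `T = [Δ, x(t₀) y(t₁) z(t₂)]`:
(1) for every representation `N` on `Δ` carrying the pulled-back integrand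
`(z(σ t₀)·2/(1+t₀)²)(y(σ t₁)·2/(1+t₁)²)(x(σ t₂)·2/(1+t₂)²)`, `[N] − [T] ∈ KZ.relations` as ONE
rule-(2) move (`l2m_moebius_sub_mem_relations`); (2) such an `N` exists
(`l2m_exists_moebiusRep`). [cite: KontsevichZagier2001, §1.2 rule (2)] -/
theorem l2w3_moebius_move :
    ∀ (x y z : ℝ → ℝ) (T : IntegralRep 3),
      T.domain = {t | 0 < t 2 ∧ t 2 < t 1 ∧ t 1 < t 0 ∧ t 0 < 1} →
      EqOn T.integrand (fun t => x (t 0) * y (t 1) * z (t 2)) T.domain →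
      (∀ N : IntegralRep 3, N.domain = {t | 0 < t 2 ∧ t 2 < t 1 ∧ t 1 < t 0 ∧ t 0 < 1} →
        EqOn N.integrand (fun t => (z ((1 - t 0) / (1 + t 0)) * (2 / (1 + t 0) ^ 2)) *
          (y ((1 - t 1) / (1 + t 1)) * (2 / (1 + t 1) ^ 2)) *
          (x ((1 - t 2) / (1 + t 2)) * (2 / (1 + t 2) ^ 2))) N.domain →
        of N - of T ∈ relations) ∧
      (∃ N : IntegralRep 3, N.domain = {t | 0 < t 2 ∧ t 2 < t 1 ∧ t 1 < t 0 ∧ t 0 < 1} ∧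
        N.integrand = fun t => (z ((1 - t 0) / (1 + t 0)) * (2 / (1 + t 0) ^ 2)) *
          (y ((1 - t 1) / (1 + t 1)) * (2 / (1 + t 1) ^ 2)) *
          (x ((1 - t 2) / (1 + t 2)) * (2 / (1 + t 2) ^ 2))) :=
  fun x y z T hTd hTi =>
    ⟨fun N hNd hNi => l2m_moebius_sub_mem_relations x y z T hTd hTi N hNd hNi,
      l2m_exists_moebiusRep x y z T hTd hTi⟩

end Summit.KontsevichZagierPeriods.HurwitzMicroSectors.NormalFormPrinciple.PiBox.M3
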